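import Mathlib
import Summits.NavierStokesRegularity.NavierStokesRegularity.Theorems.FilamentSkeletonRssStadiumPlateauStepChord
import Summits.NavierStokesRegularity.NavierStokesRegularity.Theorems.FilamentSkeletonRssStadiumLogBounds

/-!
# Route `FilamentSkeletonRss` · child crux `TangentSkeletonNearStraightL` (stmt-NavierStokesRegularity-23320) · registered line
# `child_tangent_analytic_strip_L` (b0b56c52900dd90a), stub `stub_stripPropagation` — assembly: THE LEFT SIDE OF THE REGISTERED OUTPUT CORNER, WITH NUMBERS

`Theorems.StadiumPlateauStepChord.plateau_step_chord_re_ge` instantiated at the REGISTERED quarter-width geometry with all constants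
discharged: stadium `S = {|Im| < hs, |Re − cc| < L + hs}`, `‖F′‖ ≤ 2` (the stub's `StadiumAnalyticCurve`), tangent oscillation `Rb ≤ 1/2`
(the stub's bound), a target `z = x₀ + iY` of the OUTPUT stadium near its right end (`0 ≤ Y < hs/4`, `x₀ < cc + L + hs/4`) and a plateau
chord of length `ℓ ≥ hs/2` toward the bulk (staying in the right half, `cc ≤ x₀ − ℓ`): radii `R₁ = 3hs/4` (near half), `R₂ = 24hs/25`
(far half), levels `E₁ = 1/2`, `E₂ = 29/100` (from `Theorems.StadiumLogBounds` and the series enclosure of `log(96/71)`), giving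
  `ℓ²·(3/20) ≤ Re Σᵢ (Fᵢ(z − ℓ) − Fᵢ(z))²`   (`corner_left_plateau_re_ge`)
— the long plateau chords through the registered corner are on the principal branch with relative margin `≥ 0.15`, where the sup-form
estimate of the `strip_core` architecture gives `1 − 9/8 < 0`.  (Chords `ℓ ≤ 3hs/4` are `Theorems.StadiumPlateauShortChord`; together: the whole
left side.)  Also: `log_ratio_sub_mono` (the second-order profile is increasing in the height), `sqrt_three_lt`.
HONEST FRAMING: bookkeeping for a HYPOTHETICAL filament skeleton on the NEGATIVE side of a MODEL route; the stub `stub_stripPropagation` is NOT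
closed by this file; nothing here bears on Navier–Stokes regularity or blow-up.  `--supports stmt-NavierStokesRegularity-23320`.
-/

set_option linter.dupNamespace false

noncomputable section

namespace Summit.NavierStokesRegularity.NavierStokesRegularity.Theorems.StadiumCornerLeft

open Set MeasureTheory Finset
open scoped InnerProductSpace BigOperators
open Summit.NavierStokesRegularity.NavierStokesRegularity.Theorems.StadiumPlateauStepChord
open Summit.NavierStokesRegularity.NavierStokesRegularity.Theorems.StadiumLogBounds

/-- **The second-order profile is increasing in the height**: for `0 ≤ t₁ ≤ t₂ < R`,
`log(R/(R−t₁)) − t₁/R ≤ log(R/(R−t₂)) − t₂/R`. [folklore] -/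
theorem log_ratio_sub_mono {R t₁ t₂ : ℝ} (ht₁ : 0 ≤ t₁) (h12 : t₁ ≤ t₂) (ht₂ : t₂ < R) :
    Real.log (R / (R - t₁)) - t₁ / R ≤ Real.log (R / (R - t₂)) - t₂ / R := by
  have hR : 0 < R := by linarith
  have h1 : 0 < R - t₁ := by linarith
  have h2 : 0 < R - t₂ := by linarith
  have hlog : Real.log (R / (R - t₂)) - Real.log (R / (R - t₁)) = Real.log ((R - t₁) / (R - t₂)) := by
    rw [Real.log_div hR.ne' h2.ne', Real.log_div hR.ne' h1.ne', Real.log_div h1.ne' h2.ne']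
    ring
  have hlow : 1 - ((R - t₁) / (R - t₂))⁻¹ ≤ Real.log ((R - t₁) / (R - t₂)) :=
    Real.one_sub_inv_le_log_of_pos (div_pos h1 h2)
  have hinv : ((R - t₁) / (R - t₂))⁻¹ = (R - t₂) / (R - t₁) := by rw [inv_div]
  rw [hinv] at hlow
  -- `1 − (R−t₂)/(R−t₁) = (t₂−t₁)/(R−t₁) ≥ (t₂−t₁)/R`
  have h3 : (t₂ - t₁) / R ≤ 1 - (R - t₂) / (R - t₁) := by
    rw [div_le_iff₀ hR]
    have e : (1 - (R - t₂) / (R - t₁)) * R = (t₂ - t₁) * (R / (R - t₁)) := by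
      field_simp
      ring
    rw [e]
    have h4 : 1 ≤ R / (R - t₁) := by rw [le_div_iff₀ h1]; linarith
    nlinarith
  have h5 : t₂ / R - t₁ / R = (t₂ - t₁) / R := by ring
  linarith [h5]

/-- `√3 < 1.73206`. [folklore] -/
theorem sqrt_three_lt : Real.sqrt 3 < 1.73206 := by
  rw [Real.sqrt_lt' (by norm_num)]
  norm_num

/-- `log(96/71) ≤ 0.3018` (disc ratio `96/71` of the far-half radius `24hs/25` at height `hs/4`), by the series enclosure. [folklore] -/
theorem log_96_71_le : Real.log ((96:ℝ) / 71) ≤ 0.3018 := by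
  have h := (log_div_sub_bounds (R := (24:ℝ) / 25) (t := 1 / 4) (by norm_num) (by norm_num) 6).2
  have e : (24:ℝ) / 25 / (24 / 25 - 1 / 4) = 96 / 71 := by norm_num
  rw [e] at h
  refine h.trans ?_
  simp only [Finset.sum_range_succ, Finset.sum_range_zero]
  norm_num

/-- **The left side of the registered output corner, with numbers.**  Stadium `S`, `F` holomorphic on `S` with `‖F′‖ ≤ 2`, `Σ (F′)ᵢ² = 1`,
`F = cplx ∘ X` on the real trace, `X` differentiable with unit speed and tangent oscillation `≤ Rb ≤ 1/2`; a target `z = x₀ + iY` with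
`0 ≤ Y < hs/4`, `x₀ < cc + L + hs/4`, and a plateau chord of length `ℓ ≥ hs/2` toward the bulk with `cc ≤ x₀ − ℓ`.  Then
`ℓ²·(3/20) ≤ Re Σᵢ (Fᵢ(z − ℓ) − Fᵢ(z))²`. [folklore] -/
theorem corner_left_plateau_re_ge {hs L cc : ℝ} {F : ℂ → (Fin 3 → ℂ)}
    (hF : DifferentiableOn ℂ F {z : ℂ | |z.im| < hs ∧ |z.re - cc| < L + hs})
    (hM : ∀ z ∈ {z : ℂ | |z.im| < hs ∧ |z.re - cc| < L + hs}, ‖deriv F z‖ ≤ 2)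
    (hunit : ∀ w ∈ {z : ℂ | |z.im| < hs ∧ |z.re - cc| < L + hs}, ∑ i, (deriv F w i) ^ 2 = 1)
    {X : ℝ → EuclideanSpace ℝ (Fin 3)} (hX : Differentiable ℝ X) (hXu : ∀ τ, ‖deriv X τ‖ = 1)
    {Rb : ℝ} (hRb0 : 0 ≤ Rb) (hRb : Rb ≤ 1 / 2) (hosc : ∀ τ σ, ‖deriv X τ - deriv X σ‖ ≤ Rb)
    (hFX : ∀ r : ℝ, (r : ℂ) ∈ {z : ℂ | |z.im| < hs ∧ |z.re - cc| < L + hs} →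
      F r = fun i => ((⟪X r, EuclideanSpace.single i (1:ℝ)⟫_ℝ : ℝ) : ℂ))
    (hhs : 0 < hs) {x₀ Y ℓ : ℝ} (hY0 : 0 ≤ Y) (hY : Y < hs / 4) (hx₀ : x₀ < cc + L + hs / 4)
    (hℓ : hs / 2 ≤ ℓ) (hleft : cc ≤ x₀ - ℓ) :
    ℓ ^ 2 * (3 / 20) ≤
      (∑ i, (F (((x₀ : ℂ) + (Y : ℂ) * Complex.I) + ((-ℓ : ℝ) : ℂ)) i - F ((x₀ : ℂ) + (Y : ℂ) * Complex.I) i) ^ 2).re := by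
  -- radii and levels
  have hR₁Y : Y < 3 * hs / 4 := by linarith
  have hR₁hs : 3 * hs / 4 < hs := by linarith
  have hR₂Y : Y < 24 * hs / 25 := by linarith
  have hR₂hs : 24 * hs / 25 < hs := by linarith
  have hℓ0 : 0 ≤ ℓ := by linarith
  have hnear : ∀ r ∈ Icc (0:ℝ) 1, r ≤ 1 / 2 → |x₀ + r * (-ℓ) - cc| + 3 * hs / 4 < L + hs := by
    intro r hr _
    have h1 : 0 ≤ x₀ + r * (-ℓ) - cc := by nlinarith [hr.2]
    rw [abs_of_nonneg h1]
    nlinarith [hr.1]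
  have hfar : ∀ r ∈ Icc (0:ℝ) 1, 1 / 2 < r → |x₀ + r * (-ℓ) - cc| + 24 * hs / 25 < L + hs := by
    intro r hr hr2
    have h1 : 0 ≤ x₀ + r * (-ℓ) - cc := by nlinarith [hr.2]
    rw [abs_of_nonneg h1]
    nlinarith
  -- the level at `R₁ = 3hs/4`: monotone in `Y`, value `log(3/2) − 1/3` at `hs/4`
  have h3 := sqrt_three_lt
  have hs3 : 0 ≤ Real.sqrt 3 := Real.sqrt_nonneg 3
  have hE₁ : √3 * (2 * 2 * (Real.log (3 * hs / 4 / (3 * hs / 4 - Y)) - Y / (3 * hs / 4))) ≤ 1 / 2 := by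
    have hm := log_ratio_sub_mono (R := 3 * hs / 4) hY0 hY.le (by linarith : hs / 4 < 3 * hs / 4)
    have e : 3 * hs / 4 / (3 * hs / 4 - hs / 4) = 3 / 2 := by field_simp; ring
    have e2 : hs / 4 / (3 * hs / 4) = 1 / 3 := by field_simp
    rw [e, e2] at hm
    have hc := corner_profile_ratio_three_four.1
    have hnn : 0 ≤ Real.log (3 * hs / 4 / (3 * hs / 4 - Y)) - Y / (3 * hs / 4) := by
      have h0 := log_ratio_sub_mono (R := 3 * hs / 4) le_rfl hY0 hR₁Y
      simp only [sub_zero, div_self (by positivity : (3 * hs / 4) ≠ 0), Real.log_one, zero_div] at h0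
      linarith
    nlinarith
  -- the level at `R₂ = 24hs/25`: value `log(96/71) − 25/96` at `hs/4`
  have hE₂ : √3 * (2 * 2 * (Real.log (24 * hs / 25 / (24 * hs / 25 - Y)) - Y / (24 * hs / 25))) ≤ 29 / 100 := by
    have hm := log_ratio_sub_mono (R := 24 * hs / 25) hY0 hY.le (by linarith : hs / 4 < 24 * hs / 25)
    have e : 24 * hs / 25 / (24 * hs / 25 - hs / 4) = 96 / 71 := by field_simp; ring
    have e2 : hs / 4 / (24 * hs / 25) = 25 / 96 := by field_simp; norm_num
    rw [e, e2] at hm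
    have hc := log_96_71_le
    have hnn : 0 ≤ Real.log (24 * hs / 25 / (24 * hs / 25 - Y)) - Y / (24 * hs / 25) := by
      have h0 := log_ratio_sub_mono (R := 24 * hs / 25) le_rfl hY0 hR₂Y
      simp only [sub_zero, div_self (by positivity : (24 * hs / 25) ≠ 0), Real.log_one, zero_div] at h0
      linarith
    nlinarith
  have h := plateau_step_chord_re_ge hF hM hunit hX hXu hosc hFX hhs hY0 hR₁Y hR₁hs hR₂Y hR₂hs hnear hfar hE₁ hE₂
  -- the bracket with `Rb ≤ 1/2`, `E₁ = 1/2`, `E₂ = 29/100` is at most `17/20`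
  have hbr : ((Rb + 2 * (1 / 2 : ℝ)) ^ 2 + 2 * (Rb + 1 / 2 + 29 / 100) ^ 2 + (Rb + 2 * (29 / 100)) ^ 2) / 8 ≤ 17 / 20 := by
    nlinarith
  have hℓ2 : 0 ≤ ℓ ^ 2 := sq_nonneg ℓ
  calc ℓ ^ 2 * (3 / 20) ≤ ℓ ^ 2 * (1 - ((Rb + 2 * (1 / 2 : ℝ)) ^ 2 + 2 * (Rb + 1 / 2 + 29 / 100) ^ 2 +
        (Rb + 2 * (29 / 100)) ^ 2) / 8) := mul_le_mul_of_nonneg_left (by linarith) hℓ2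
    _ ≤ _ := h

end Summit.NavierStokesRegularity.NavierStokesRegularity.Theorems.StadiumCornerLeft

end
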